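import Summits.BirchSwinnertonDyer.BirchSwinnertonDyer.Theorems.ByReductionTypeAtTwoAdditivePotMultConjATwoNarrowStampsBClass
import Summits.BirchSwinnertonDyer.BirchSwinnertonDyer.Theorems.ByReductionTypeAtTwoAdditivePotMultConjATwoNarrowRoadKitReal
import HarnessLib

/-!
# C4″ `AdditivePotMultOverKAtTwo` (item stmt-BirchSwinnertonDyer-22618), the (I1M′) input of the upper half on the `0 < Δ` rows:
# NARROW STAMPS, part B / FIELD — the totally real cubic `2`-torsion field of discriminant `44248` (`X³ + (0)X² + (-25)X + (-26)`): irreducibility, odd class number,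
# three located real embeddings, the layer-`0` unit certificate `#(U⁺/U²) = 2`, the one bit `2 ∤ h(ℚ(θ,√2))`, Fukuda's index `0` (KERNEL; rows 442480a1)

Cell `bsd-2adic`, rung K4, seat `bsd-2adic-k4-w3` GEN 12 (explicit unit of director-bsd g16 (309)(7); `--supports stmt-BirchSwinnertonDyer-22618`).
HONEST FRAMING (D-0036/D-0054/D-0152): THEOREMS ONLY (no definition, no named fact, no `sorry`, no instance). The five files `…NarrowStampsB{{Class,Field,Units,Layer,Rows}}`
carry k4-w1's zero-hypothesis narrow-Fukuda road (`conjA_two_445508b1''`) for ONE totally real cubic field `ℚ(θ)` (eng-2's reduced cubic of the rows'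
`2`-division field, or an odd-index generator of it) through the GEN 12 kit (`…NarrowRoadKit{{,Squares,Doors,Real}}`): FIELD = `irreducible_cubic_d44248p`,
`odd_classNumber_of_root_d44248p` (norm certificate below the Minkowski bound, GEN 11's generator), `exists_three_ringHom_adjoin_d44248p` / `isTotallyReal_adjoin_d44248p`,
`unitCertificate_adjoin_d44248p` / `card_totPosUnitsModSq_adjoin_d44248p` (`#(U⁺/U²) = 2`: a mixed-sign unit and a totally positive unit that is a quadratic non-residue
modulo a principal prime), `layerOneBit_d44248p` (`2 ∤ h(ℚ(θ,√2))`: Chevalley's door at `2` with a `2`-adic non-norm unit, k4-w1 `layerOneBit_of_chevalleyCert`),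
`totallyRamifiedFrom_zero_adjoin_d44248p` (even-index certificate); LAYER = `card_totPosUnitsModSq_sup_layer_one_d44248p` (five units of `ℚ(θ,√2)`, algebraic integers by
their monic sextics: UNITS file `layerUnits_d44248p`, with an invertible `5 × 5` sign matrix at five real embeddings, every entry by rational interval arithmetic on the located roots) and
**`narrowIndex_eq_d44248p`** (both narrow indices `= 2`); ROWS = `conjA_two_<L>'`, Coates–Sujatha's statement (A) at `p = 2` for the census cubic model of each
Cremona class, PROVED OUTRIGHT by the kit's door `conjA_two_cubicModel_of_narrowRoad` (cruxlead-19573-w2's NARROW FUKUDA + Kida-lite + kernel Lim 3.5@2).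
All certificates were found by the seat's exact-arithmetic tools (`tools/narrowcert.py`: k4-w2 GEN 12's unit lattice search `nf6/units`, GEN 11's `index3/cubiccert5`
for the `2`-adic and class-number data, `fieldiso`) and are CHECKED HERE by the kernel; eng-2's certified numerics (CERT-ADD-POTMULT-POS81-AB-E2: `(a) ORDER cert ∧
(b) NARROW-EQUAL01 cert`, `h⁺ = 2h` at layers `0, 1`) agree. These are the FIRST kernel (A)₂ rows on the `Δ > 0` half of (I1M′). Statement (A) is NOT BSD:
BSD₂ for these curves is not proved; C4″ / (I1M′) stay research-open; nothing booked; no row of 22618 changes tier (pen RC-490 (4)); BSD is not proved by any of this.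

References: [CoatesSujatha2005] Conj. A, Thm. 3.4; [Fukuda1994] Thm. 1 (2); [FrohlichTaylor1990] Ch. V §1 (1.8)–(1.13); [Lang1990] Ch. 13 §4 Lemma 4.1;
[Washington1997] §13.1, Prop. 13.2; [Cohen1993] §4.1.3, §6.3; [Marcus1977] Ch. 5 Thm. 22, 35–37; cell file `eng2/fukuda269/pos81/TABLE-ADD-POTMULT-POS81-AB-E2-v1.tsv`.
-/

set_option autoImplicit false
-- sibling precedent (`…NarrowRankStamp445508b1.lean`): the directory name repeats the summit name
set_option linter.dupNamespace false

noncomputable section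
open scoped Classical IntermediateField NumberField Real nonZeroDivisors
namespace Summit.BirchSwinnertonDyer.BirchSwinnertonDyer.Theorems.AddKatoTwo
open WeierstrassCurve Field Polynomial IsDedekindDomain NumberField Matrix IntermediateField Literature.NumberTheory.EllipticCurves
  Literature.NumberTheory.EllipticCurves.ZpExtension
  Literature.NumberTheory.GaloisRepresentations Literature.NumberTheory.IwasawaTheory Literature.NumberTheory.NumberFields
  Literature.Geometry.Kaehler.ComplexTorus
  Summit.BirchSwinnertonDyer.BirchSwinnertonDyer.Theorems.SteinbergFibreAtTwo
  Summit.BirchSwinnertonDyer.BirchSwinnertonDyer.Theorems.AlignedTransportAtTwoTorsionPointField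
  Summit.BirchSwinnertonDyer.BirchSwinnertonDyer.Theorems.SteinbergFibreAtTwo.NarrowRankCert

/-! ## Real embeddings of `ℚ(θ)`, `θ³ + (0)θ² + (-25)θ + (-26) = 0` (totally real, `d = 44248`) -/

section Embeddings

variable {θ : AlgebraicClosure ℚ}

/-- The cubic relation as a real equation gives a root of `Cubic.toPoly` over `ℝ`. [folklore] -/
private theorem aeval_real_of_eq_d44248p {x : ℝ} (hx : x ^ 3 + (0) * x ^ 2 + (-25) * x + (-26) = 0) :
    aeval x (Cubic.toPoly ⟨1, ((0 : ℤ) : ℚ), ((-25 : ℤ) : ℚ), ((-26 : ℤ) : ℚ)⟩) = 0 := by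
  simp only [Cubic.toPoly, map_one, one_mul, aeval_add, aeval_mul, aeval_C, aeval_X_pow, aeval_X, eq_ratCast,
    Rat.cast_intCast]
  push_cast
  linear_combination hx

/-- **The three real embeddings of `ℚ(θ)`**, with located images (rational intervals of width `10⁻16`; IVT + lifting).
[cite: Cohen1993, §4.1.3 (real roots and signatures)] -/
theorem exists_three_ringHom_adjoin_d44248p (hθ : aeval θ (Cubic.toPoly ⟨1, ((0 : ℤ) : ℚ), ((-25 : ℤ) : ℚ), ((-26 : ℤ) : ℚ)⟩) = 0) :
    ∃ (ρ₀ ρ₁ ρ₂ : ↥ℚ⟮θ⟯ →+* ℝ) (x0 x1 x2 : ℝ),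
      ρ₀ (AdjoinSimple.gen ℚ θ) = x0 ∧ ρ₁ (AdjoinSimple.gen ℚ θ) = x1 ∧ ρ₂ (AdjoinSimple.gen ℚ θ) = x2 ∧
      ((-21818415693556349 : ℝ) / 5000000000000000) < x0 ∧ x0 < ((-43636831387112697 : ℝ) / 10000000000000000) ∧
      ((-1092101328542131 : ℝ) / 1000000000000000) < x1 ∧ x1 < ((-10921013285421309 : ℝ) / 10000000000000000) ∧
      ((54557844672534007 : ℝ) / 10000000000000000) < x2 ∧ x2 < ((6819730584066751 : ℝ) / 1250000000000000) := by
  obtain ⟨x0, hl0, hu0, hx0⟩ := exists_cubic_root_Ioo_of_neg_of_pos (p := (0 : ℝ)) (q := (-25)) (r := (-26))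
    (l := (-21818415693556349 / 5000000000000000)) (u := (-43636831387112697 / 10000000000000000)) (by norm_num) (by norm_num) (by norm_num)
  obtain ⟨x1, hl1, hu1, hx1⟩ := exists_cubic_root_Ioo_of_pos_of_neg (p := (0 : ℝ)) (q := (-25)) (r := (-26))
    (l := (-1092101328542131 / 1000000000000000)) (u := (-10921013285421309 / 10000000000000000)) (by norm_num) (by norm_num) (by norm_num)
  obtain ⟨x2, hl2, hu2, hx2⟩ := exists_cubic_root_Ioo_of_neg_of_pos (p := (0 : ℝ)) (q := (-25)) (r := (-26))
    (l := (54557844672534007 / 10000000000000000)) (u := (6819730584066751 / 1250000000000000)) (by norm_num) (by norm_num) (by norm_num)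
  obtain ⟨ρ₀, hρ₀⟩ := exists_ringHom_adjoin_apply_gen_eq (P := ⟨1, ((0 : ℤ) : ℚ), ((-25 : ℤ) : ℚ), ((-26 : ℤ) : ℚ)⟩) rfl
    irreducible_cubic_d44248p hθ (aeval_real_of_eq_d44248p hx0)
  obtain ⟨ρ₁, hρ₁⟩ := exists_ringHom_adjoin_apply_gen_eq (P := ⟨1, ((0 : ℤ) : ℚ), ((-25 : ℤ) : ℚ), ((-26 : ℤ) : ℚ)⟩) rfl
    irreducible_cubic_d44248p hθ (aeval_real_of_eq_d44248p hx1)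
  obtain ⟨ρ₂, hρ₂⟩ := exists_ringHom_adjoin_apply_gen_eq (P := ⟨1, ((0 : ℤ) : ℚ), ((-25 : ℤ) : ℚ), ((-26 : ℤ) : ℚ)⟩) rfl
    irreducible_cubic_d44248p hθ (aeval_real_of_eq_d44248p hx2)
  exact ⟨ρ₀, ρ₁, ρ₂, x0, x1, x2, hρ₀, hρ₁, hρ₂, hl0, hu0, hl1, hu1, hl2, hu2⟩

/-- **`ℚ(θ)` is TOTALLY REAL** (three distinct real embeddings, degree `3`). [cite: Cohen1993, §4.1.3] -/
theorem isTotallyReal_adjoin_d44248p (hθ : aeval θ (Cubic.toPoly ⟨1, ((0 : ℤ) : ℚ), ((-25 : ℤ) : ℚ), ((-26 : ℤ) : ℚ)⟩) = 0) :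
    haveI : FiniteDimensional ℚ ↥ℚ⟮θ⟯ :=
      IntermediateField.adjoin.finiteDimensional ⟨_, Cubic.monic_of_a_eq_one', by rwa [← aeval_def]⟩
    haveI : NumberField ↥ℚ⟮θ⟯ := NumberField.mk
    IsTotallyReal ↥ℚ⟮θ⟯ := by
  haveI : FiniteDimensional ℚ ↥ℚ⟮θ⟯ :=
      IntermediateField.adjoin.finiteDimensional ⟨_, Cubic.monic_of_a_eq_one', by rwa [← aeval_def]⟩
  haveI : NumberField ↥ℚ⟮θ⟯ := NumberField.mk
  have h3 : Module.finrank ℚ ↥ℚ⟮θ⟯ = 3 := finrank_adjoin_eq_three_of_irreducible irreducible_cubic_d44248p hθ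
  obtain ⟨ρ₀, ρ₁, ρ₂, x0, x1, x2, hρ₀, hρ₁, hρ₂, hl0, hu0, hl1, hu1, hl2, hu2⟩ := exists_three_ringHom_adjoin_d44248p hθ
  have hne : ∀ {φ ψ : ↥ℚ⟮θ⟯ →+* ℝ} {a c : ℝ}, φ (AdjoinSimple.gen ℚ θ) = a → ψ (AdjoinSimple.gen ℚ θ) = c → a ≠ c → φ ≠ ψ := by
    intro φ ψ a c ha hc hac h; rw [h] at ha; exact hac (ha.symm.trans hc)
  have h01 : ρ₀ ≠ ρ₁ := hne hρ₀ hρ₁ (by intro h; linarith)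
  have h02 : ρ₀ ≠ ρ₂ := hne hρ₀ hρ₂ (by intro h; linarith)
  have h12 : ρ₁ ≠ ρ₂ := hne hρ₁ hρ₂ (by intro h; linarith)
  refine isTotallyReal_of_three_realEmbeddings h3 ![ρ₀, ρ₁, ρ₂] ?_
  intro a c hac
  fin_cases a <;> fin_cases c <;> simp_all

end Embeddings

/-! ## The unit certificate of `ℚ(θ)`: `#(U⁺/U²) = 2` -/

section UnitsE

variable {θ : AlgebraicClosure ℚ}

set_option maxHeartbeats 800000 in
/-- **The layer-`0` unit certificate of `ℚ(θ)`, `θ³ + (0)θ² + (-25)θ + (-26) = 0`** (`d = 44248`; units found by the seat's lattice search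
`tools/narrowcert.py`, verified EXACTLY here): three located real embeddings `ρ₀ ρ₁ ρ₂`; the unit `ε = (-71) + (-47)θ + (11)θ²` is positive at
`ρ₀` and negative at `ρ₁` (`#sign(U) ≥ 4` with `−1`); the unit `u₀ = (4169) + (4773)θ + (875)θ²` is TOTALLY POSITIVE and NOT a unit
square (`u₀ ≡ -6 (mod π)`, `π = (-3) + (-5)θ + (-1)θ²`, `|N(π)| = 17`, `-6` a non-residue mod `17`) ⟹ **`#(U⁺/U²)(ℚ(θ)) = 2`**
(kit `card_totPosUnitsModSq_eq_two_of_cubic_certificate`). The witnesses are algebraic integers by their monic cubics (`exists_intElem_of_scaled_cubic`).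
[cite: FrohlichTaylor1990, Ch. V §1 (1.12)–(1.13), p. 164] [cite: Cohen1993, §4.1.3 and §6.3] -/
theorem unitCertificate_adjoin_d44248p (hθ : aeval θ (Cubic.toPoly ⟨1, ((0 : ℤ) : ℚ), ((-25 : ℤ) : ℚ), ((-26 : ℤ) : ℚ)⟩) = 0) :
    haveI : FiniteDimensional ℚ ↥ℚ⟮θ⟯ :=
      IntermediateField.adjoin.finiteDimensional ⟨_, Cubic.monic_of_a_eq_one', by rwa [← aeval_def]⟩
    haveI : NumberField ↥ℚ⟮θ⟯ := NumberField.mk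
    ∃ (ρ₀ ρ₁ ρ₂ : ↥ℚ⟮θ⟯ →+* ℝ) (x0 x1 x2 : ℝ) (u : (𝓞 ↥ℚ⟮θ⟯)ˣ),
      ρ₀ (AdjoinSimple.gen ℚ θ) = x0 ∧ ρ₁ (AdjoinSimple.gen ℚ θ) = x1 ∧ ρ₂ (AdjoinSimple.gen ℚ θ) = x2 ∧
      (((-21818415693556349 : ℝ) / 5000000000000000) < x0 ∧ x0 < ((-43636831387112697 : ℝ) / 10000000000000000) ∧
      ((-1092101328542131 : ℝ) / 1000000000000000) < x1 ∧ x1 < ((-10921013285421309 : ℝ) / 10000000000000000) ∧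
      ((54557844672534007 : ℝ) / 10000000000000000) < x2 ∧ x2 < ((6819730584066751 : ℝ) / 1250000000000000)) ∧
      (∀ σ : ↥ℚ⟮θ⟯ →+* ℝ, 0 < σ ((u : 𝓞 ↥ℚ⟮θ⟯) : ↥ℚ⟮θ⟯)) ∧ (¬ ∃ w : (𝓞 ↥ℚ⟮θ⟯)ˣ, u = w ^ 2) ∧
      Nat.card (TotPosUnitsModSq ↥ℚ⟮θ⟯) = 2 := by
  haveI : FiniteDimensional ℚ ↥ℚ⟮θ⟯ :=
      IntermediateField.adjoin.finiteDimensional ⟨_, Cubic.monic_of_a_eq_one', by rwa [← aeval_def]⟩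
  haveI : NumberField ↥ℚ⟮θ⟯ := NumberField.mk
  haveI : IsTotallyReal ↥ℚ⟮θ⟯ := isTotallyReal_adjoin_d44248p hθ
  have h3 : Module.finrank ℚ ↥ℚ⟮θ⟯ = 3 := finrank_adjoin_eq_three_of_irreducible irreducible_cubic_d44248p hθ
  obtain ⟨ρ₀, ρ₁, ρ₂, x0, x1, x2, hρ₀, hρ₁, hρ₂, hl0, hu0, hl1, hu1, hl2, hu2⟩ := exists_three_ringHom_adjoin_d44248p hθ
  have hne : ∀ {φ ψ : ↥ℚ⟮θ⟯ →+* ℝ} {a c : ℝ}, φ (AdjoinSimple.gen ℚ θ) = a → ψ (AdjoinSimple.gen ℚ θ) = c → a ≠ c → φ ≠ ψ := by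
    intro φ ψ a c ha hc hac h; rw [h] at ha; exact hac (ha.symm.trans hc)
  have h01 : ρ₀ ≠ ρ₁ := hne hρ₀ hρ₁ (by intro h; linarith)
  have h02 : ρ₀ ≠ ρ₂ := hne hρ₀ hρ₂ (by intro h; linarith)
  have h12 : ρ₁ ≠ ρ₂ := hne hρ₁ hρ₂ (by intro h; linarith)
  obtain ⟨b, hbθ, hb⟩ := exists_ringOfIntegers_cubic_root (p := 0) (q := -25) (r := -26) hθ
  have hbgen : algebraMap (𝓞 ↥ℚ⟮θ⟯) ↥ℚ⟮θ⟯ b = AdjoinSimple.gen ℚ θ := Subtype.ext hbθ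
  have hb' : b ^ 3 + (0 : 𝓞 ↥ℚ⟮θ⟯) * b ^ 2 + (-25 : 𝓞 ↥ℚ⟮θ⟯) * b + (-26 : 𝓞 ↥ℚ⟮θ⟯) = 0 := by push_cast at hb; linear_combination hb
  -- values of `ℤ[θ]`-elements under a real embedding
  have hval : ∀ (σ : ↥ℚ⟮θ⟯ →+* ℝ) (x : ℝ), σ (AdjoinSimple.gen ℚ θ) = x → ∀ (a₀ a₁ a₂ : ℤ),
      σ ((a₀ : ↥ℚ⟮θ⟯) + (a₁ : ↥ℚ⟮θ⟯) * AdjoinSimple.gen ℚ θ + (a₂ : ↥ℚ⟮θ⟯) * AdjoinSimple.gen ℚ θ ^ 2) = a₀ + a₁ * x + a₂ * x ^ 2 := by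
    intro σ x hx a₀ a₁ a₂
    rw [map_add, map_add, map_mul, map_mul, map_pow, hx, map_intCast, map_intCast, map_intCast]
  obtain ⟨E1, hE1m, -⟩ := exists_intElem_of_scaled_cubic _ b (-71) (-47) (11) (m := 1) (by norm_num) (-337) (-2251) (-1)
    (by push_cast; linear_combination (((72958 : 𝓞 ↥ℚ⟮θ⟯)) + ((39622 : 𝓞 ↥ℚ⟮θ⟯)) * b + ((-17061 : 𝓞 ↥ℚ⟮θ⟯)) * b ^ 2 + ((1331 : 𝓞 ↥ℚ⟮θ⟯)) * b ^ 3) * hb')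
  have hE1m' : (1 : 𝓞 ↥ℚ⟮θ⟯) * E1 = ((-71 : ℤ) : 𝓞 ↥ℚ⟮θ⟯) + ((-47 : ℤ) : 𝓞 ↥ℚ⟮θ⟯) * b + ((11 : ℤ) : 𝓞 ↥ℚ⟮θ⟯) * b ^ 2 := by exact_mod_cast hE1m
  obtain ⟨E2, hE2m, -⟩ := exists_intElem_of_scaled_cubic _ b (-167) (-191) (-35) (m := 1) (by norm_num) (2251) (337) (-1)
    (by push_cast; linear_combination (((-2233246 : 𝓞 ↥ℚ⟮θ⟯)) + ((-2758630 : 𝓞 ↥ℚ⟮θ⟯)) * b + ((-701925 : 𝓞 ↥ℚ⟮θ⟯)) * b ^ 2 + ((-42875 : 𝓞 ↥ℚ⟮θ⟯)) * b ^ 3) * hb')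
  have hE2m' : (1 : 𝓞 ↥ℚ⟮θ⟯) * E2 = ((-167 : ℤ) : 𝓞 ↥ℚ⟮θ⟯) + ((-191 : ℤ) : 𝓞 ↥ℚ⟮θ⟯) * b + ((-35 : ℤ) : 𝓞 ↥ℚ⟮θ⟯) * b ^ 2 := by exact_mod_cast hE2m
  have hE1E2 : E1 * E2 = 1 := by
    have h2 : (1 : 𝓞 ↥ℚ⟮θ⟯) * (E1 * E2) = (1 : 𝓞 ↥ℚ⟮θ⟯) * 1 := by
      linear_combination ((1 : 𝓞 ↥ℚ⟮θ⟯) * E2) * hE1m' + (((-71 : ℤ) : 𝓞 ↥ℚ⟮θ⟯) + ((-47 : ℤ) : 𝓞 ↥ℚ⟮θ⟯) * b + ((11 : ℤ) : 𝓞 ↥ℚ⟮θ⟯) * b ^ 2) * hE2m' + (((-456 : 𝓞 ↥ℚ⟮θ⟯)) + ((-385 : 𝓞 ↥ℚ⟮θ⟯)) * b) * hb'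
    exact mul_left_cancel₀ (by norm_num) h2
  set e : (𝓞 ↥ℚ⟮θ⟯)ˣ := Units.mkOfMulEqOne E1 E2 hE1E2 with hedef
  obtain ⟨U1, hU1m, -⟩ := exists_intElem_of_scaled_cubic _ b (4169) (4773) (875) (m := 1) (by norm_num) (-56257) (149333) (-1)
    (by push_cast; linear_combination (((34796003542 : 𝓞 ↥ℚ⟮θ⟯)) + ((43053466750 : 𝓞 ↥ℚ⟮θ⟯)) * b + ((10962984375 : 𝓞 ↥ℚ⟮θ⟯)) * b ^ 2 + ((669921875 : 𝓞 ↥ℚ⟮θ⟯)) * b ^ 3) * hb')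
  have hU1m' : (1 : 𝓞 ↥ℚ⟮θ⟯) * U1 = ((4169 : ℤ) : 𝓞 ↥ℚ⟮θ⟯) + ((4773 : ℤ) : 𝓞 ↥ℚ⟮θ⟯) * b + ((875 : ℤ) : 𝓞 ↥ℚ⟮θ⟯) * b ^ 2 := by exact_mod_cast hU1m
  obtain ⟨U2, hU2m, -⟩ := exists_intElem_of_scaled_cubic _ b (165961) (7613) (-6971) (m := 1) (by norm_num) (-149333) (56257) (-1)
    (by push_cast; linear_combination (((-17615201169814 : 𝓞 ↥ℚ⟮θ⟯)) + ((7256795092178 : 𝓞 ↥ℚ⟮θ⟯)) * b + ((1109857573599 : 𝓞 ↥ℚ⟮θ⟯)) * b ^ 2 + ((-338754636611 : 𝓞 ↥ℚ⟮θ⟯)) * b ^ 3) * hb')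
  have hU2m' : (1 : 𝓞 ↥ℚ⟮θ⟯) * U2 = ((165961 : ℤ) : 𝓞 ↥ℚ⟮θ⟯) + ((7613 : ℤ) : 𝓞 ↥ℚ⟮θ⟯) * b + ((-6971 : ℤ) : 𝓞 ↥ℚ⟮θ⟯) * b ^ 2 := by exact_mod_cast hU2m
  have hU1U2 : U1 * U2 = 1 := by
    have h2 : (1 : 𝓞 ↥ℚ⟮θ⟯) * (U1 * U2) = (1 : 𝓞 ↥ℚ⟮θ⟯) * 1 := by
      linear_combination ((1 : 𝓞 ↥ℚ⟮θ⟯) * U2) * hU1m' + (((4169 : ℤ) : 𝓞 ↥ℚ⟮θ⟯) + ((4773 : ℤ) : 𝓞 ↥ℚ⟮θ⟯) * b + ((875 : ℤ) : 𝓞 ↥ℚ⟮θ⟯) * b ^ 2) * hU2m' + (((-26611208 : 𝓞 ↥ℚ⟮θ⟯)) + ((-6099625 : 𝓞 ↥ℚ⟮θ⟯)) * b) * hb'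
    exact mul_left_cancel₀ (by norm_num) h2
  set u : (𝓞 ↥ℚ⟮θ⟯)ˣ := Units.mkOfMulEqOne U1 U2 hU1U2 with hudef
  have heK : ((1 : ℕ) : ↥ℚ⟮θ⟯) * ((e : 𝓞 ↥ℚ⟮θ⟯) : ↥ℚ⟮θ⟯) = ((-71 : ℤ) : ↥ℚ⟮θ⟯) + ((-47 : ℤ) : ↥ℚ⟮θ⟯) * AdjoinSimple.gen ℚ θ + ((11 : ℤ) : ↥ℚ⟮θ⟯) * AdjoinSimple.gen ℚ θ ^ 2 := by
    rw [hedef, Units.val_mkOfMulEqOne, NumberField.RingOfIntegers.coe_eq_algebraMap]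
    have h := congrArg (algebraMap (𝓞 ↥ℚ⟮θ⟯) ↥ℚ⟮θ⟯) hE1m
    simpa only [map_mul, map_natCast, map_add, map_intCast, map_pow, hbgen] using h
  have huK : ((1 : ℕ) : ↥ℚ⟮θ⟯) * ((u : 𝓞 ↥ℚ⟮θ⟯) : ↥ℚ⟮θ⟯) = ((4169 : ℤ) : ↥ℚ⟮θ⟯) + ((4773 : ℤ) : ↥ℚ⟮θ⟯) * AdjoinSimple.gen ℚ θ + ((875 : ℤ) : ↥ℚ⟮θ⟯) * AdjoinSimple.gen ℚ θ ^ 2 := by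
    rw [hudef, Units.val_mkOfMulEqOne, NumberField.RingOfIntegers.coe_eq_algebraMap]
    have h := congrArg (algebraMap (𝓞 ↥ℚ⟮θ⟯) ↥ℚ⟮θ⟯) hU1m
    simpa only [map_mul, map_natCast, map_add, map_intCast, map_pow, hbgen] using h
  have he_pos : 0 < ρ₀ ((e : 𝓞 ↥ℚ⟮θ⟯) : ↥ℚ⟮θ⟯) := by
    refine embedding_pos_of_scaled_pos ρ₀ e (d := 1) (by norm_num) heK ?_
    rw [hval ρ₀ x0 hρ₀]; push_cast
    exact quadratic_pos_of_endpoints (m := (34355214340523309651169195964751899 / 100000000000000000000000000000000)) hl0.le hu0.le (by norm_num) (by norm_num) (by norm_num) (by norm_num)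
  have he_neg : ρ₁ ((e : 𝓞 ↥ℚ⟮θ⟯) : ↥ℚ⟮θ⟯) < 0 := by
    refine embedding_neg_of_scaled_neg ρ₁ e (d := 1) (by norm_num) heK ?_
    rw [hval ρ₁ x1 hρ₁]; push_cast
    exact quadratic_neg_of_endpoints (m := (6551699128681479901667737767229 / 1000000000000000000000000000000)) hl1.le hu1.le (by norm_num) (by norm_num) (by norm_num) (by norm_num)
  have hv_pos0 : 0 < ρ₀ (((4169 : ℤ) : ↥ℚ⟮θ⟯) + ((4773 : ℤ) : ↥ℚ⟮θ⟯) * AdjoinSimple.gen ℚ θ + ((875 : ℤ) : ↥ℚ⟮θ⟯) * AdjoinSimple.gen ℚ θ ^ 2) := by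
    rw [hval ρ₀ x0 hρ₀]; push_cast
    exact quadratic_pos_of_endpoints (m := (2123677696014543718579250296663 / 800000000000000000000000000000)) hl0.le hu0.le (by norm_num) (by norm_num) (by norm_num) (by norm_num)
  have hv_pos1 : 0 < ρ₁ (((4169 : ℤ) : ↥ℚ⟮θ⟯) + ((4773 : ℤ) : ↥ℚ⟮θ⟯) * AdjoinSimple.gen ℚ θ + ((875 : ℤ) : ↥ℚ⟮θ⟯) * AdjoinSimple.gen ℚ θ ^ 2) := by
    rw [hval ρ₁ x1 hρ₁]; push_cast
    exact quadratic_pos_of_endpoints (m := (53571682776756894148127 / 8000000000000000000000000000)) hl1.le hu1.le (by norm_num) (by norm_num) (by norm_num) (by norm_num)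
  have hv_pos2 : 0 < ρ₂ (((4169 : ℤ) : ↥ℚ⟮θ⟯) + ((4773 : ℤ) : ↥ℚ⟮θ⟯) * AdjoinSimple.gen ℚ θ + ((875 : ℤ) : ↥ℚ⟮θ⟯) * AdjoinSimple.gen ℚ θ ^ 2) := by
    rw [hval ρ₂ x2 hρ₂]; push_cast
    exact quadratic_pos_of_endpoints (m := (45003476316946816539406646000332343 / 800000000000000000000000000000)) hl2.le hu2.le (by norm_num) (by norm_num) (by norm_num) (by norm_num)
  have hpos : ∀ σ : ↥ℚ⟮θ⟯ →+* ℝ, 0 < σ ((u : 𝓞 ↥ℚ⟮θ⟯) : ↥ℚ⟮θ⟯) :=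
    forall_embedding_pos_of_scaled u (d := 1) (by norm_num) huK (forall_ringHom_pos_of_three h3 h01 h02 h12 _ hv_pos0 hv_pos1 hv_pos2)
  -- `u₀ ≡ -6 (mod π)`, `π = (-3) + (-5)b + (-1)b²`, `|N(π)| = 17`, `-6` a non-residue mod `17`; `κ = (u₀ − -6)/π ∈ 𝓞`
  have hπ : (Algebra.norm ℤ (((-3 : ℤ) : 𝓞 ↥ℚ⟮θ⟯) + ((-5 : ℤ) : 𝓞 ↥ℚ⟮θ⟯) * b + ((-1 : ℤ) : 𝓞 ↥ℚ⟮θ⟯) * b ^ 2)).natAbs = 17 := by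
    have hN := natAbs_norm_coords_eq_natAbs_normPoly _ h3 b (p := 0) (q := -25) (r := -26) irreducible_cubic_d44248p hb (-3) (-5) (-1)
    rw [hN]; norm_num
  obtain ⟨Kap, hKapm, -⟩ := exists_intElem_of_scaled_cubic _ b (-57) (-74) (-16) (m := 1) (by norm_num) (971) (31695) (-171851)
    (by push_cast; linear_combination (((-38120 : 𝓞 ↥ℚ⟮θ⟯)) + ((-160448 : 𝓞 ↥ℚ⟮θ⟯)) * b + ((-56832 : 𝓞 ↥ℚ⟮θ⟯)) * b ^ 2 + ((-4096 : 𝓞 ↥ℚ⟮θ⟯)) * b ^ 3) * hb')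
  have hKapm' : (1 : 𝓞 ↥ℚ⟮θ⟯) * Kap = ((-57 : ℤ) : 𝓞 ↥ℚ⟮θ⟯) + ((-74 : ℤ) : 𝓞 ↥ℚ⟮θ⟯) * b + ((-16 : ℤ) : 𝓞 ↥ℚ⟮θ⟯) * b ^ 2 := by exact_mod_cast hKapm
  have hmem : (u : 𝓞 ↥ℚ⟮θ⟯) - (-6 : ℤ) ∈ Ideal.span {((-3 : ℤ) : 𝓞 ↥ℚ⟮θ⟯) + ((-5 : ℤ) : 𝓞 ↥ℚ⟮θ⟯) * b + ((-1 : ℤ) : 𝓞 ↥ℚ⟮θ⟯) * b ^ 2} := by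
    rw [Ideal.mem_span_singleton']
    refine ⟨Kap, ?_⟩
    have h : (1 : 𝓞 ↥ℚ⟮θ⟯) * (Kap * (((-3 : ℤ) : 𝓞 ↥ℚ⟮θ⟯) + ((-5 : ℤ) : 𝓞 ↥ℚ⟮θ⟯) * b + ((-1 : ℤ) : 𝓞 ↥ℚ⟮θ⟯) * b ^ 2)) = (1 : 𝓞 ↥ℚ⟮θ⟯) * ((u : 𝓞 ↥ℚ⟮θ⟯) - (-6 : ℤ)) := by
      rw [hudef, Units.val_mkOfMulEqOne]
      push_cast
      linear_combination ((1 : 𝓞 ↥ℚ⟮θ⟯) * (((-3 : ℤ) : 𝓞 ↥ℚ⟮θ⟯) + ((-5 : ℤ) : 𝓞 ↥ℚ⟮θ⟯) * b + ((-1 : ℤ) : 𝓞 ↥ℚ⟮θ⟯) * b ^ 2)) * hKapm' + (-(1 : 𝓞 ↥ℚ⟮θ⟯)) * hU1m' + (-(((-154 : 𝓞 ↥ℚ⟮θ⟯)) + ((-16 : 𝓞 ↥ℚ⟮θ⟯)) * b)) * hb'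
    exact mul_left_cancel₀ (by norm_num) h
  have hns : ¬ ∃ w : (𝓞 ↥ℚ⟮θ⟯)ˣ, u = w ^ 2 :=
    not_exists_sq_eq_of_residue u _ (by norm_num : Nat.Prime 17) hπ (-6) hmem (by decide)
  have hcard := card_totPosUnitsModSq_eq_two_of_cubic_certificate h3 ρ₀ ρ₁ e he_pos he_neg u hpos hns
  exact ⟨ρ₀, ρ₁, ρ₂, x0, x1, x2, u, hρ₀, hρ₁, hρ₂, ⟨hl0, hu0, hl1, hu1, hl2, hu2⟩, hpos, hns, hcard⟩

/-- **`#(U⁺/U²)(ℚ(θ)) = 2`** (narrow defect `1`) for `θ³ + (0)θ² + (-25)θ + (-26) = 0`. KERNEL. [cite: FrohlichTaylor1990, Ch. V §1 (1.12)–(1.13)] -/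
theorem card_totPosUnitsModSq_adjoin_d44248p (hθ : aeval θ (Cubic.toPoly ⟨1, ((0 : ℤ) : ℚ), ((-25 : ℤ) : ℚ), ((-26 : ℤ) : ℚ)⟩) = 0) :
    haveI : FiniteDimensional ℚ ↥ℚ⟮θ⟯ :=
      IntermediateField.adjoin.finiteDimensional ⟨_, Cubic.monic_of_a_eq_one', by rwa [← aeval_def]⟩
    haveI : NumberField ↥ℚ⟮θ⟯ := NumberField.mk
    Nat.card (TotPosUnitsModSq ↥ℚ⟮θ⟯) = 2 := by
  obtain ⟨-, -, -, -, -, -, -, -, -, -, -, -, -, h⟩ := unitCertificate_adjoin_d44248p hθ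
  exact h

end UnitsE

/-! ## `h(ℚ(θ))` odd, the one-bit certificate (`2 ∤ h(ℚ(θ, √2))`), Fukuda's index `0` -/

section TwoAdic

variable {θ : AlgebraicClosure ℚ}

/-- `h(ℚ(θ))` is odd (the norm certificate `odd_classNumber_of_root_d44248p` at `ℚ(θ)`). -/
theorem odd_classNumber_adjoin_d44248p (hθ : aeval θ (Cubic.toPoly ⟨1, ((0 : ℤ) : ℚ), ((-25 : ℤ) : ℚ), ((-26 : ℤ) : ℚ)⟩) = 0) :
    haveI : FiniteDimensional ℚ ↥ℚ⟮θ⟯ :=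
      IntermediateField.adjoin.finiteDimensional ⟨_, Cubic.monic_of_a_eq_one', by rwa [← aeval_def]⟩
    haveI : NumberField ↥ℚ⟮θ⟯ := NumberField.mk
    Odd (classNumber ↥ℚ⟮θ⟯) := by
  haveI : FiniteDimensional ℚ ↥ℚ⟮θ⟯ :=
      IntermediateField.adjoin.finiteDimensional ⟨_, Cubic.monic_of_a_eq_one', by rwa [← aeval_def]⟩
  haveI : NumberField ↥ℚ⟮θ⟯ := NumberField.mk
  obtain ⟨b, -, hb⟩ := exists_ringOfIntegers_cubic_root (p := 0) (q := -25) (r := -26) hθ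
  exact odd_classNumber_of_root_d44248p ↥ℚ⟮θ⟯ (finrank_adjoin_eq_three_of_irreducible irreducible_cubic_d44248p hθ) b hb

/-- **The one bit `e₁ = 0`: `2 ∤ h` of the first layer of every cyclotomic `ℤ₂`-extension of `ℚ(θ)`** (Chevalley's door at `2`,
k4-w1 `layerOneBit_of_chevalleyCert`): `h(ℚ(θ))` odd, at most two primes above `2` (`4 ∤ g(0)`, `4 ∤ g(1)`), and the unit
`ε = (-71) + (-47)θ + (11)θ²` (`ε³ + (-337)ε² + (-2251)ε + (-1) = 0`) has `ε ≡ 3 (mod 8)` under `θ ↦ z₂ ≡ 6` (`8 ∣ g(6)`, `g'(6)` odd):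
a non-norm from `ℚ(θ, √2)`. KERNEL. [cite: Lang1990, Ch. 13 §4, Lemma 4.1] [cite: Washington1997, §13.1] -/
theorem layerOneBit_d44248p (hθ : aeval θ (Cubic.toPoly ⟨1, ((0 : ℤ) : ℚ), ((-25 : ℤ) : ℚ), ((-26 : ℤ) : ℚ)⟩) = 0) :
    haveI : FiniteDimensional ℚ (IntermediateField.adjoin ℚ {θ}) :=
      IntermediateField.adjoin.finiteDimensional ((AlgebraicClosure.isAlgebraic ℚ).isAlgebraic θ).isIntegral
    haveI : NumberField (IntermediateField.adjoin ℚ {θ}) := NumberField.mk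
    ∀ κL : ZpExtension (IntermediateField.adjoin ℚ {θ}) 2, κL.IsCyclotomic → classNumberPExp κL 1 = 0 := by
  have hθ' : θ ^ 3 + (0 : AlgebraicClosure ℚ) * θ ^ 2 + (-25 : AlgebraicClosure ℚ) * θ + (-26 : AlgebraicClosure ℚ) = 0 := by
    have := hθ
    simp only [Cubic.toPoly, map_one, one_mul, aeval_add, aeval_mul, aeval_C, aeval_X_pow, aeval_X,
      eq_ratCast, Rat.cast_intCast] at this
    push_cast at this
    linear_combination this
  have he : aeval (algebraMap ℚ (AlgebraicClosure ℚ) (((-71 : ℤ) : ℚ) / ((1 : ℤ) : ℚ)) +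
      algebraMap ℚ (AlgebraicClosure ℚ) (((-47 : ℤ) : ℚ) / ((1 : ℤ) : ℚ)) * θ +
      algebraMap ℚ (AlgebraicClosure ℚ) (((11 : ℤ) : ℚ) / ((1 : ℤ) : ℚ)) * θ ^ 2)
      (Cubic.toPoly ⟨1, ((-337 : ℤ) : ℚ), ((-2251 : ℤ) : ℚ), ((-1 : ℤ) : ℚ)⟩) = 0 := by
    simp only [Cubic.toPoly, map_one, one_mul, aeval_add, aeval_mul, aeval_C, aeval_X_pow, aeval_X, eq_ratCast,
      Rat.cast_intCast, Rat.cast_div]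
    push_cast
    linear_combination ((72958 : AlgebraicClosure ℚ) + (39622 : AlgebraicClosure ℚ) * θ + (-17061 : AlgebraicClosure ℚ) * θ ^ 2 + (1331 : AlgebraicClosure ℚ) * θ ^ 3) * hθ'
  have hh := not_two_dvd_card_classGroup_adjoin_of_forall_cubicField_odd irreducible_cubic_d44248p (odd_classNumber_of_root_d44248p) hθ
  exact layerOneBit_of_chevalleyCert irreducible_cubic_d44248p hθ hh ⟨0, by norm_num⟩ ⟨0, by norm_num⟩
    (-71) (-47) (11) (1) (-337) (-2251) (-1) (by norm_num) he (6) (1) (by norm_num) (by norm_num) (by decide) (by decide)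

/-- **Fukuda's index is `0` for every cyclotomic `ℤ₂`-extension of `ℚ(θ)`** (`2 = 𝔭𝔮²`): the EVEN-INDEX CERTIFICATE
`u = [-2, -1, -1]`, `v = [0, 0, -1]`, `m = [14, 7, -5]`, `m' = [-812, -452, 267]` in the basis `1, θ, θ²` (`u² − 2v² = 4m`, `m² = 2m'`, `8 ∤ N(2 − m'³)`), fed to
`totallyRamifiedFrom_zero_of_evenIndexCertificate` (kernel). [cite: Fukuda1994, Thm. 1, p. 264] [cite: Washington1997, §13.1] -/
theorem totallyRamifiedFrom_zero_adjoin_d44248p (hθ : aeval θ (Cubic.toPoly ⟨1, ((0 : ℤ) : ℚ), ((-25 : ℤ) : ℚ), ((-26 : ℤ) : ℚ)⟩) = 0) :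
    haveI : FiniteDimensional ℚ ↥ℚ⟮θ⟯ :=
      IntermediateField.adjoin.finiteDimensional ⟨_, Cubic.monic_of_a_eq_one', by rwa [← aeval_def]⟩
    haveI : NumberField ↥ℚ⟮θ⟯ := NumberField.mk
    ∀ κP : ZpExtension ↥ℚ⟮θ⟯ 2, κP.IsCyclotomic → TotallyRamifiedFrom κP 0 := by
  haveI : FiniteDimensional ℚ ↥ℚ⟮θ⟯ :=
      IntermediateField.adjoin.finiteDimensional ⟨_, Cubic.monic_of_a_eq_one', by rwa [← aeval_def]⟩
  haveI : NumberField ↥ℚ⟮θ⟯ := NumberField.mk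
  intro κP hκP
  have h3 : Module.finrank ℚ ↥ℚ⟮θ⟯ = 3 := finrank_adjoin_eq_three_of_irreducible irreducible_cubic_d44248p hθ
  obtain ⟨B, -, hB⟩ := exists_ringOfIntegers_cubic_root (p := 0) (q := -25) (r := -26) hθ
  refine totallyRamifiedFrom_zero_of_evenIndexCertificate h3 κP hκP
    (((-2 : ℤ) : 𝓞 ↥ℚ⟮θ⟯) + ((-1 : ℤ) : 𝓞 ↥ℚ⟮θ⟯) * B + ((-1 : ℤ) : 𝓞 ↥ℚ⟮θ⟯) * B ^ 2) (((0 : ℤ) : 𝓞 ↥ℚ⟮θ⟯) + ((0 : ℤ) : 𝓞 ↥ℚ⟮θ⟯) * B + ((-1 : ℤ) : 𝓞 ↥ℚ⟮θ⟯) * B ^ 2) (((14 : ℤ) : 𝓞 ↥ℚ⟮θ⟯) + ((7 : ℤ) : 𝓞 ↥ℚ⟮θ⟯) * B + ((-5 : ℤ) : 𝓞 ↥ℚ⟮θ⟯) * B ^ 2) (((-812 : ℤ) : 𝓞 ↥ℚ⟮θ⟯) + ((-452 : ℤ) : 𝓞 ↥ℚ⟮θ⟯) * B + ((267 : ℤ)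 : 𝓞 ↥ℚ⟮θ⟯) * B ^ 2) ?_ ?_ ?_
  · push_cast; linear_combination (((2 : 𝓞 ↥ℚ⟮θ⟯)) + ((-1 : 𝓞 ↥ℚ⟮θ⟯)) * B) * hB
  · push_cast; linear_combination (((-70 : 𝓞 ↥ℚ⟮θ⟯)) + ((25 : 𝓞 ↥ℚ⟮θ⟯)) * B) * hB
  · have hz : (2 : 𝓞 ↥ℚ⟮θ⟯) - (((-812 : ℤ) : 𝓞 ↥ℚ⟮θ⟯) + ((-452 : ℤ) : 𝓞 ↥ℚ⟮θ⟯) * B + ((267 : ℤ) : 𝓞 ↥ℚ⟮θ⟯) * B ^ 2) ^ 3 =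
        ((37616114702 : ℤ) : 𝓞 ↥ℚ⟮θ⟯) + ((24436735064 : ℤ) : 𝓞 ↥ℚ⟮θ⟯) * B + ((-9163124391 : ℤ) : 𝓞 ↥ℚ⟮θ⟯) * B ^ 2 := by
      push_cast; linear_combination (((1426181822 : 𝓞 ↥ℚ⟮θ⟯)) + ((-465841575 : 𝓞 ↥ℚ⟮θ⟯)) * B + ((96667884 : 𝓞 ↥ℚ⟮θ⟯)) * B ^ 2 + ((-19034163 : 𝓞 ↥ℚ⟮θ⟯)) * B ^ 3) * hB
    rw [hz]
    exact not_eight_dvd_norm_coords _ h3 B irreducible_cubic_d44248p hB (37616114702) (24436735064) (-9163124391) (N := 49569271851783289970050)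
      (by simp only [Matrix.one_fin_three, Matrix.det_fin_three, Matrix.add_apply, Matrix.smul_apply, sq, Matrix.mul_apply,
        Fin.sum_univ_three, Matrix.of_apply, Matrix.cons_val', Matrix.cons_val_zero, Matrix.cons_val_one, Matrix.cons_val_two,
        Matrix.head_cons, Matrix.tail_cons, Matrix.empty_val', Matrix.cons_val_fin_one, smul_eq_mul]; norm_num) (by norm_num)

end TwoAdic

end Summit.BirchSwinnertonDyer.BirchSwinnertonDyer.Theorems.AddKatoTwo

end
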